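import Mathlib
import Summits.Schanuel.Schanuel.Theses.TwistedConjugacy
import Summits.Schanuel.Schanuel.Theorems.TwistedSymmetry.Negative.ForcedValues

/-!
# No measurable twisted symmetry (negative lemma for `TwistedSymmetry`, stmt-Schanuel-17222)

Strategist artefact (cstrat r1).  `ForcedValues.lean` shows that a twisted symmetry
`σ : ℂ →+* ℂ` (fixing `ℚ̄`, `σ (exp z) = exp (μ * σ z)`, `μ ≠ 1`) cannot be continuous.
Here the "tame witness" loophole is closed one step further: `σ` cannot even be
Borel-measurable, because a measurable additive homomorphism of the locally compact group `ℂ`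
into the real normed space `ℂ` is automatically continuous
(`MeasureTheory.Measure.AddMonoidHom.continuous_of_measurable`, the Steinhaus–Pettis mechanism).

Consequence for the strategy census: the characteristic-`p` lever being transferred
(Denis 1995: the *continuous* automorphism `T ↦ ξT` of `𝔽_q((1/T))` twisting the Carlitz
exponential) has no measurable, let alone continuous, analogue in characteristic `0`; any witness
of `TwistedSymmetry` is a wild (choice-dependent) map, so no analytic or descriptive-set-theoretic
construction can produce it.
-/

namespace Summit.Schanuel.Schanuel.Theorems.TwistedSymmetry.Negative

open Complex

/-- A twisted symmetry is never Borel measurable: measurable additive homs `ℂ → ℂ` are continuous,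
and continuous ring endomorphisms of `ℂ` are `id` or `conj`, neither of which twists `exp`.
[folklore] -/
theorem twist_not_measurable {μ : ℂ} {σ : ℂ →+* ℂ} (hμ : μ ≠ 1)
    (hfix : ∀ a : ℂ, IsAlgebraic ℚ a → σ a = a)
    (htw : ∀ z : ℂ, σ (exp z) = exp (μ * σ z)) : ¬ Measurable σ := by
  intro hm
  have hc : Continuous σ.toAddMonoidHom :=
    MeasureTheory.Measure.AddMonoidHom.continuous_of_measurable σ.toAddMonoidHom hm
  exact twist_not_continuous hμ hfix htw hc

/-- NEGATIVE LEMMA (the natural "measurable witness" strengthening is false): there is no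
Borel-measurable twisted symmetry. [folklore] -/
theorem not_twistedSymmetry_measurable :
    ¬ ∃ μ : ℂ, IsAlgebraic ℚ μ ∧ ‖μ‖ = 1 ∧ (∀ n : ℕ, 0 < n → μ ^ n ≠ 1) ∧ ∃ σ : ℂ →+* ℂ,
      Measurable σ ∧ (∀ a : ℂ, IsAlgebraic ℚ a → σ a = a) ∧
        ∀ z : ℂ, σ (Complex.exp z) = Complex.exp (μ * σ z) := by
  rintro ⟨μ, -, -, hroot, σ, hm, hfix, htw⟩
  have hμ : μ ≠ 1 := fun h => hroot 1 one_pos (by simp [h])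
  exact twist_not_measurable hμ hfix htw hm

/-- Packaged against the route decl: every witness of `TwistedSymmetry` is a non-measurable
(in particular discontinuous, non-`ℝ`-linear) ring endomorphism of `ℂ`. [folklore] -/
theorem twistedSymmetry_witness_not_measurable
    (h : Summit.Schanuel.Schanuel.Theses.TwistedConjugacy.TwistedSymmetry) :
    ∃ μ : ℂ, ∃ σ : ℂ →+* ℂ, μ ≠ 1 ∧ (∀ a : ℂ, IsAlgebraic ℚ a → σ a = a) ∧
      (∀ z : ℂ, σ (exp z) = exp (μ * σ z)) ∧ ¬ Measurable σ ∧ ¬ Continuous σ := by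
  obtain ⟨μ, -, -, hroot, σ, hfix, htw⟩ := h
  have hμ : μ ≠ 1 := fun h => hroot 1 one_pos (by simp [h])
  exact ⟨μ, σ, hμ, hfix, htw, twist_not_measurable hμ hfix htw, twist_not_continuous hμ hfix htw⟩

end Summit.Schanuel.Schanuel.Theorems.TwistedSymmetry.Negative
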